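import Summits.Langlands.Langlands.Theses.SqrtFiveQuarticCovers

/-!
# BIRTH SKELETON (BC3) — crux stmt-Langlands-17833 `SqrtFiveQuarticCovers.RefinedLocusModular`
(route `route-Langlands-SqrtFiveQuarticCovers`, crux rank 2), line `birth` = the route header's own
TWO-LAYER PLAN, typed: the finite certificate is cut along the crux's mod-5 disjunction (`H12 | H8`, the
planner's "RefinedLocusH12 → RefinedLocusH8", k = 2) and its mod-7 disjunction ("or by level at 7: b7-curves
first, then e7"), i.e. into the FOUR pairs of determinant-refined curves
`X(u3, v5, w7)`, `u ∈ {b, s}` (kept together: the mod-3 hypothesis is not split), `v ∈ {H12, H8}`, `w ∈ {b7, e7}`.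

Registered by `planner-skel-stmt-Langlands-17833-0` (skeleton registrar, 2026-08-17).

## The crux (verbatim, `Iff.rfl`-read back at the end of this file)

For `K` totally real quartic with `√5 ∈ K` and `E/K` (integral Weierstrass model, `Δ ≠ 0`) whose mod-3 image is
Borel or inside `C_s⁺(3)`, whose mod-5 image is inside `H8 = ⟨diag(2,3), antidiag(1,1)⟩ ≅ D₄` or inside
`H12 = ⟨(3 1; 3 3), diag(1,4)⟩ ≅ D₆` (for some framing of `E[5]`), and whose mod-7 image is Borel or inside
`G(e7)`: `E` is modular (geometric CM, or a weight-zero cuspidal `π` on `GL₂(𝔸_K)` with `T_w ↦ a_w(E)` at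
cofinitely many `w` — `IsModularEllipticCurve` written out, cone repair rev 5).

## The cut (4 stubs, each a genuine finite certificate; none is the crux or the summit in costume)

* `stub_H12_b7` — the `(v, w) = (H12, b7)` pair: curves `X(b3,H12,b7)` (index 640, the smallest of the eight)
  and `X(s3,H12,b7)` (index 960).  The natural FIRST kit target of the route (CHEAPEST FALSIFIER paragraph of
  the route header: quotient genera / ℚ(√5)-ranks of `X(b3,H12,b7)`).
* `stub_H8_b7` — the `(H8, b7)` pair: `X(b3,H8,b7)` (index 960), `X(s3,H8,b7)` (index 1440).
* `stub_H12_e7` — the `(H12, e7)` pair: indices 3360, 5040.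
* `stub_H8_e7` — the `(H8, e7)` pair: indices 5040, 7560 (genus ≈ 630) — the HARDEST stub (largest genera; the
  crux's own `why it might fail` — no quotient tree on which symmetric Chabauty over ℚ(√5) closes — bites here first).

Each stub has exactly the crux's binders with the mod-5 and mod-7 disjunctions SPECIALISED to one disjunct; the
mod-3 hypothesis (Borel ∨ C_s⁺(3)), the framing clauses (`e : E[p](K̄) ≃+ (ℤ/p)²` with `e(σ•P) = ρ(σ)·e(P)`,
= `WeierstrassCurve.IsTorsionGaloisRep p ρ` written out) and the conclusion are verbatim.  Mechanism per stub
(not typed further — no modular-curve-points carrier in the tree yet, grounder g71-1's definition gap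
`ModularCurveLevelStructurePoints`): `E` gives a `K`-point, i.e. a quadratic point over ℚ(√5), on one of the two
curves of the pair; PSL₂(ℤ)-index ≥ 640 ⇒ gonality ≥ 7·640/800 > 4 (Abramovich) ⇒ finitely many quadratic points
over ℚ(√5) (Harris–Silverman); determine them (Box2021 quotient models, BoxGajovicGoodman2021 symmetric Chabauty
over a real quadratic base + Mordell–Weil sieve) and certify each non-cuspidal non-CM point modular
(ℚ-curve / base change from ℚ(√5) (FLS: real quadratic) / Faltings–Serre against a computed Hilbert newform).
[cite: Box2022, §7.1] [cite: FreitasLeHungSiksek2015, Remark (iii) after Cor. 2.1] [cite: BoxGajovicGoodman2021]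
[cite: Box2021] [cite: DerickxNajmanSiksek2020]

Composition: `RefinedLocusModular_of : RefinedLocusModular` (BY NAME; body = destructure the mod-5 and mod-7
hypotheses, four-way case split, each case one stub re-packed with its disjunct) — the shape
`#h21_check_skeleton` registers; the hypothetical form `<stub₁-sig> → … → <stub₄-sig> → RefinedLocusModular`
(pure logic, sorry-free) is the `example` right after it, and four further `example`s show each stub is a
CONSEQUENCE of the crux (so no stub is harder than the crux).  Sorries: exactly 4, one per stub, zero elsewhere.

Disproof used: none — no `Disproof.lean` on this crux at registration time (`ledger crux ls stmt-Langlands-17833`: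
no workfiles).  Dead lines: none recorded.  Negatives index: untouched (no refuted statement about elliptic curves
over totally real fields).  Barriers: as the route header — `ResiduallyReducibleBarrier` evaded (small-image curves
are enumerated as points, never lifted); the others not in play for these four finite certificates.

Leans on (by name): `Summit.Langlands.Langlands.Theses.SqrtFiveQuarticCovers.RefinedLocusModular` (the crux),
`Literature.NumberTheory.GaloisRepresentations.FramedGaloisRep`, `WeierstrassCurve.baseChange`, `….geomTorsion`,
`….HasCM`, `Literature.NumberTheory.Automorphic.isCompact_glFiniteIntegralLevel`, `…CuspidalAutomorphicRepData`,
`…AutomorphicRepData.HasWeightZero`, `…HasSatakeParamAt`, `…frobTraceAt`, `NumberField.IsTotallyReal` — all in the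
cone of the route file (its only import besides Mathlib/HarnessLib is `Summits.Langlands.Statement`).
-/

-- `Summit.Langlands.Langlands.…`: summit = sub-problem name (D-0017 nested layout), not a typo.
set_option linter.dupNamespace false
set_option linter.style.longLine false

namespace Summit.Langlands.Langlands.Cruxes.RefinedLocusModular.Birth

-- the route file's own `open`s, so that the verbatim crux sub-terms below elaborate exactly as in the route file
open scoped BigOperators Topology Manifold Classical MeasureTheory ProbabilityTheory Matrix InnerProductSpace ComplexConjugate ContinuousMap
open Filter Set Function TopologicalSpace MeasureTheory
open Summit.Langlands.Langlands.Theses.SqrtFiveQuarticCovers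

/-- **STUB 1 — `stub_H12_b7`: the two refined curves `X(b3, H12, b7)` (PSL₂(ℤ)-index 640, genus ≈ 50) and `X(s3, H12, b7)` (index 960).**  For `K` totally real quartic with `√5 ∈ K` and `E/K`
(`Δ ≠ 0`) with mod-3 image Borel or inside `C_s⁺(3)`, mod-5 image inside `H12 = ⟨(3 1; 3 3), diag(1,4)⟩ ≅ D₆ ⊂ C_ns⁺(5)` and mod-7 image BOREL (each for some
framing of `E[p]`): `E` is modular (CM, or a weight-zero cuspidal `π` on `GL₂(𝔸_K)` with `T_w ↦ a_w(E)` cofinitely).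
A finite certificate: the ℚ(√5)-quadratic points of the two curves (finitely many: index ≥ 640 ⇒ gonality > 4,
Abramovich + Harris–Silverman), each non-cuspidal non-CM one certified modular. OPEN (computational, not in print:
Box2022 §7.1 leaves the `√5 ∈ K` residue unresolved). [cite: Box2022, §7.1] [cite: FreitasLeHungSiksek2015, Rem. (iii)] -/
theorem stub_H12_b7 :
    ∀ (K : Type) [Field K] [NumberField K], NumberField.IsTotallyReal K → Module.finrank ℚ K = 4 →
      (∃ r : K, r ^ 2 = 5) → ∀ E : WeierstrassCurve (NumberField.RingOfIntegers K), E.Δ ≠ 0 →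
      (∃ ρ : Literature.NumberTheory.GaloisRepresentations.FramedGaloisRep K (ZMod 3) 2, (∃ e : (E.baseChange K).geomTorsion ((3 : ℕ) : ℤ) ≃+ (Fin 2 → ZMod 3), ∀ (σ : Field.absoluteGaloisGroup K) (P : (E.baseChange K).geomTorsion ((3 : ℕ) : ℤ)), e (σ • P) = ((ρ σ : GL (Fin 2) (ZMod 3)) : Matrix (Fin 2) (Fin 2) (ZMod 3)) *ᵥ (e P)) ∧ ((∀ σ : Field.absoluteGaloisGroup K, (((ρ σ : GL (Fin 2) (ZMod 3)) : Matrix (Fin 2) (Fin 2) (ZMod 3)) 1 0 = 0)) ∨ (∀ σ : Field.absoluteGaloisGroup K, (ρ σ : GL (Fin 2) (ZMod 3)) ∈ Subgroup.closure ({(⟨!![1, 0; 0, 2], !![1, 0; 0, 2], by decide, by decide⟩ : GL (Fin 2) (ZMod 3)), (⟨!![0, 1; 1, 0], !![0, 1; 1, 0], by decide, by decide⟩ : GL (Fin 2) (ZMod 3))} : Set (GL (Fin 2) (ZMod 3)))))) →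
      (∃ ρ : Literature.NumberTheory.GaloisRepresentations.FramedGaloisRep K (ZMod 5) 2, (∃ e : (E.baseChange K).geomTorsion ((5 : ℕ) : ℤ) ≃+ (Fin 2 → ZMod 5), ∀ (σ : Field.absoluteGaloisGroup K) (P : (E.baseChange K).geomTorsion ((5 : ℕ) : ℤ)), e (σ • P) = ((ρ σ : GL (Fin 2) (ZMod 5)) : Matrix (Fin 2) (Fin 2) (ZMod 5)) *ᵥ (e P)) ∧ (∀ σ : Field.absoluteGaloisGroup K, (ρ σ : GL (Fin 2) (ZMod 5)) ∈ Subgroup.closure ({(⟨!![3, 1; 3, 3], !![3, 4; 2, 3], by decide, by decide⟩ : GL (Fin 2) (ZMod 5)), (⟨!![1, 0; 0, 4], !![1, 0; 0, 4], by decide, by decide⟩ : GL (Fin 2) (ZMod 5))} : Set (GL (Fin 2) (ZMod 5))))) →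
      (∃ ρ : Literature.NumberTheory.GaloisRepresentations.FramedGaloisRep K (ZMod 7) 2, (∃ e : (E.baseChange K).geomTorsion ((7 : ℕ) : ℤ) ≃+ (Fin 2 → ZMod 7), ∀ (σ : Field.absoluteGaloisGroup K) (P : (E.baseChange K).geomTorsion ((7 : ℕ) : ℤ)), e (σ • P) = ((ρ σ : GL (Fin 2) (ZMod 7)) : Matrix (Fin 2) (Fin 2) (ZMod 7)) *ᵥ (e P)) ∧ (∀ σ : Field.absoluteGaloisGroup K, (((ρ σ : GL (Fin 2) (ZMod 7)) : Matrix (Fin 2) (Fin 2) (ZMod 7)) 1 0 = 0))) →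
      ((E.baseChange K).HasCM ∨ ∃ (hF : Literature.NumberTheory.Automorphic.isCompact_glFiniteIntegralLevel 2 K) (π : Literature.NumberTheory.Automorphic.CuspidalAutomorphicRepData 2 K hF), π.1.HasWeightZero ∧ ∀ᶠ w : IsDedekindDomain.HeightOneSpectrum (NumberField.RingOfIntegers K) in Filter.cofinite, ∃ α : Multiset ℂ, π.1.HasSatakeParamAt w α ∧ ((Real.sqrt w.residueCard : ℝ) : ℂ) * α.sum = (Literature.NumberTheory.Automorphic.frobTraceAt E w : ℂ)) := by
  sorry

/-- **STUB 2 — `stub_H8_b7`: the two refined curves `X(b3, H8, b7)` (index 960) and `X(s3, H8, b7)` (index 1440).**  For `K` totally real quartic with `√5 ∈ K` and `E/K`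
(`Δ ≠ 0`) with mod-3 image Borel or inside `C_s⁺(3)`, mod-5 image inside `H8 = ⟨diag(2,3), antidiag(1,1)⟩ ≅ D₄ ⊂ C_s⁺(5)` and mod-7 image BOREL (each for some
framing of `E[p]`): `E` is modular (CM, or a weight-zero cuspidal `π` on `GL₂(𝔸_K)` with `T_w ↦ a_w(E)` cofinitely).
A finite certificate: the ℚ(√5)-quadratic points of the two curves (finitely many: index ≥ 640 ⇒ gonality > 4,
Abramovich + Harris–Silverman), each non-cuspidal non-CM one certified modular. OPEN (computational, not in print:
Box2022 §7.1 leaves the `√5 ∈ K` residue unresolved). [cite: Box2022, §7.1] [cite: FreitasLeHungSiksek2015, Rem. (iii)] -/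
theorem stub_H8_b7 :
    ∀ (K : Type) [Field K] [NumberField K], NumberField.IsTotallyReal K → Module.finrank ℚ K = 4 →
      (∃ r : K, r ^ 2 = 5) → ∀ E : WeierstrassCurve (NumberField.RingOfIntegers K), E.Δ ≠ 0 →
      (∃ ρ : Literature.NumberTheory.GaloisRepresentations.FramedGaloisRep K (ZMod 3) 2, (∃ e : (E.baseChange K).geomTorsion ((3 : ℕ) : ℤ) ≃+ (Fin 2 → ZMod 3), ∀ (σ : Field.absoluteGaloisGroup K) (P : (E.baseChange K).geomTorsion ((3 : ℕ) : ℤ)), e (σ • P) = ((ρ σ : GL (Fin 2) (ZMod 3)) : Matrix (Fin 2) (Fin 2) (ZMod 3)) *ᵥ (e P)) ∧ ((∀ σ : Field.absoluteGaloisGroup K, (((ρ σ : GL (Fin 2) (ZMod 3)) : Matrix (Fin 2) (Fin 2) (ZMod 3)) 1 0 = 0)) ∨ (∀ σ : Field.absoluteGaloisGroup K, (ρ σ : GL (Fin 2) (ZMod 3)) ∈ Subgroup.closure ({(⟨!![1, 0; 0, 2], !![1, 0; 0, 2], by decide, by decide⟩ : GL (Fin 2) (ZMod 3)), (⟨!![0,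 1; 1, 0], !![0, 1; 1, 0], by decide, by decide⟩ : GL (Fin 2) (ZMod 3))} : Set (GL (Fin 2) (ZMod 3)))))) →
      (∃ ρ : Literature.NumberTheory.GaloisRepresentations.FramedGaloisRep K (ZMod 5) 2, (∃ e : (E.baseChange K).geomTorsion ((5 : ℕ) : ℤ) ≃+ (Fin 2 → ZMod 5), ∀ (σ : Field.absoluteGaloisGroup K) (P : (E.baseChange K).geomTorsion ((5 : ℕ) : ℤ)), e (σ • P) = ((ρ σ : GL (Fin 2) (ZMod 5)) : Matrix (Fin 2) (Fin 2) (ZMod 5)) *ᵥ (e P)) ∧ (∀ σ : Field.absoluteGaloisGroup K, (ρ σ : GL (Fin 2) (ZMod 5)) ∈ Subgroup.closure ({(⟨!![2, 0; 0, 3], !![3, 0; 0, 2], by decide, by decide⟩ : GL (Fin 2) (ZMod 5)), (⟨!![0, 1; 1, 0], !![0, 1; 1, 0], by decide, by decide⟩ : GL (Fin 2) (ZMod 5))} : Set (GL (Fin 2) (ZMod 5))))) →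
      (∃ ρ : Literature.NumberTheory.GaloisRepresentations.FramedGaloisRep K (ZMod 7) 2, (∃ e : (E.baseChange K).geomTorsion ((7 : ℕ) : ℤ) ≃+ (Fin 2 → ZMod 7), ∀ (σ : Field.absoluteGaloisGroup K) (P : (E.baseChange K).geomTorsion ((7 : ℕ) : ℤ)), e (σ • P) = ((ρ σ : GL (Fin 2) (ZMod 7)) : Matrix (Fin 2) (Fin 2) (ZMod 7)) *ᵥ (e P)) ∧ (∀ σ : Field.absoluteGaloisGroup K, (((ρ σ : GL (Fin 2) (ZMod 7)) : Matrix (Fin 2) (Fin 2) (ZMod 7)) 1 0 = 0))) →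
      ((E.baseChange K).HasCM ∨ ∃ (hF : Literature.NumberTheory.Automorphic.isCompact_glFiniteIntegralLevel 2 K) (π : Literature.NumberTheory.Automorphic.CuspidalAutomorphicRepData 2 K hF), π.1.HasWeightZero ∧ ∀ᶠ w : IsDedekindDomain.HeightOneSpectrum (NumberField.RingOfIntegers K) in Filter.cofinite, ∃ α : Multiset ℂ, π.1.HasSatakeParamAt w α ∧ ((Real.sqrt w.residueCard : ℝ) : ℂ) * α.sum = (Literature.NumberTheory.Automorphic.frobTraceAt E w : ℂ)) := by
  sorry

/-- **STUB 3 — `stub_H12_e7`: the two refined curves `X(b3, H12, e7)` (index 3360) and `X(s3, H12, e7)` (index 5040).**  For `K` totally real quartic with `√5 ∈ K` and `E/K`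
(`Δ ≠ 0`) with mod-3 image Borel or inside `C_s⁺(3)`, mod-5 image inside `H12` and mod-7 image inside `G(e7) = ⟨(0 5; 3 0), (5 0; 3 2)⟩` (index 2 in C_ns⁺(7)) (each for some
framing of `E[p]`): `E` is modular (CM, or a weight-zero cuspidal `π` on `GL₂(𝔸_K)` with `T_w ↦ a_w(E)` cofinitely).
A finite certificate: the ℚ(√5)-quadratic points of the two curves (finitely many: index ≥ 640 ⇒ gonality > 4,
Abramovich + Harris–Silverman), each non-cuspidal non-CM one certified modular. OPEN (computational, not in print:
Box2022 §7.1 leaves the `√5 ∈ K` residue unresolved). [cite: Box2022, §7.1] [cite: FreitasLeHungSiksek2015, Rem. (iii)] -/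
theorem stub_H12_e7 :
    ∀ (K : Type) [Field K] [NumberField K], NumberField.IsTotallyReal K → Module.finrank ℚ K = 4 →
      (∃ r : K, r ^ 2 = 5) → ∀ E : WeierstrassCurve (NumberField.RingOfIntegers K), E.Δ ≠ 0 →
      (∃ ρ : Literature.NumberTheory.GaloisRepresentations.FramedGaloisRep K (ZMod 3) 2, (∃ e : (E.baseChange K).geomTorsion ((3 : ℕ) : ℤ) ≃+ (Fin 2 → ZMod 3), ∀ (σ : Field.absoluteGaloisGroup K) (P : (E.baseChange K).geomTorsion ((3 : ℕ) : ℤ)), e (σ • P) = ((ρ σ : GL (Fin 2) (ZMod 3)) : Matrix (Fin 2) (Fin 2) (ZMod 3)) *ᵥ (e P)) ∧ ((∀ σ : Field.absoluteGaloisGroup K, (((ρ σ : GL (Fin 2) (ZMod 3)) : Matrix (Fin 2) (Fin 2) (ZMod 3)) 1 0 = 0)) ∨ (∀ σ : Field.absoluteGaloisGroup K, (ρ σ : GL (Fin 2) (ZMod 3)) ∈ Subgroup.closure ({(⟨!![1, 0; 0, 2], !![1, 0; 0, 2], by decide, by decide⟩ : GL (Fin 2) (ZMod 3)), (⟨!![0,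 1; 1, 0], !![0, 1; 1, 0], by decide, by decide⟩ : GL (Fin 2) (ZMod 3))} : Set (GL (Fin 2) (ZMod 3)))))) →
      (∃ ρ : Literature.NumberTheory.GaloisRepresentations.FramedGaloisRep K (ZMod 5) 2, (∃ e : (E.baseChange K).geomTorsion ((5 : ℕ) : ℤ) ≃+ (Fin 2 → ZMod 5), ∀ (σ : Field.absoluteGaloisGroup K) (P : (E.baseChange K).geomTorsion ((5 : ℕ) : ℤ)), e (σ • P) = ((ρ σ : GL (Fin 2) (ZMod 5)) : Matrix (Fin 2) (Fin 2) (ZMod 5)) *ᵥ (e P)) ∧ (∀ σ : Field.absoluteGaloisGroup K, (ρ σ : GL (Fin 2) (ZMod 5)) ∈ Subgroup.closure ({(⟨!![3, 1; 3, 3], !![3, 4; 2, 3], by decide, by decide⟩ : GL (Fin 2) (ZMod 5)), (⟨!![1, 0; 0, 4], !![1, 0; 0, 4], by decide, by decide⟩ : GL (Fin 2) (ZMod 5))} : Set (GL (Fin 2) (ZMod 5))))) →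
      (∃ ρ : Literature.NumberTheory.GaloisRepresentations.FramedGaloisRep K (ZMod 7) 2, (∃ e : (E.baseChange K).geomTorsion ((7 : ℕ) : ℤ) ≃+ (Fin 2 → ZMod 7), ∀ (σ : Field.absoluteGaloisGroup K) (P : (E.baseChange K).geomTorsion ((7 : ℕ) : ℤ)), e (σ • P) = ((ρ σ : GL (Fin 2) (ZMod 7)) : Matrix (Fin 2) (Fin 2) (ZMod 7)) *ᵥ (e P)) ∧ (∀ σ : Field.absoluteGaloisGroup K, (ρ σ : GL (Fin 2) (ZMod 7)) ∈ Subgroup.closure ({(⟨!![0, 5; 3, 0], !![0, 5; 3, 0], by decide, by decide⟩ : GL (Fin 2) (ZMod 7)), (⟨!![5, 0; 3, 2], !![3, 0; 6, 4], by decide, by decide⟩ : GL (Fin 2) (ZMod 7))} : Set (GL (Fin 2) (ZMod 7))))) →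
      ((E.baseChange K).HasCM ∨ ∃ (hF : Literature.NumberTheory.Automorphic.isCompact_glFiniteIntegralLevel 2 K) (π : Literature.NumberTheory.Automorphic.CuspidalAutomorphicRepData 2 K hF), π.1.HasWeightZero ∧ ∀ᶠ w : IsDedekindDomain.HeightOneSpectrum (NumberField.RingOfIntegers K) in Filter.cofinite, ∃ α : Multiset ℂ, π.1.HasSatakeParamAt w α ∧ ((Real.sqrt w.residueCard : ℝ) : ℂ) * α.sum = (Literature.NumberTheory.Automorphic.frobTraceAt E w : ℂ)) := by
  sorry

/-- **STUB 4 — `stub_H8_e7`: the two refined curves `X(b3, H8, e7)` (index 5040) and `X(s3, H8, e7)` (index 7560, genus ≈ 630).**  For `K` totally real quartic with `√5 ∈ K` and `E/K`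
(`Δ ≠ 0`) with mod-3 image Borel or inside `C_s⁺(3)`, mod-5 image inside `H8` and mod-7 image inside `G(e7)` (each for some
framing of `E[p]`): `E` is modular (CM, or a weight-zero cuspidal `π` on `GL₂(𝔸_K)` with `T_w ↦ a_w(E)` cofinitely).
A finite certificate: the ℚ(√5)-quadratic points of the two curves (finitely many: index ≥ 640 ⇒ gonality > 4,
Abramovich + Harris–Silverman), each non-cuspidal non-CM one certified modular. OPEN (computational, not in print:
Box2022 §7.1 leaves the `√5 ∈ K` residue unresolved). [cite: Box2022, §7.1] [cite: FreitasLeHungSiksek2015, Rem. (iii)] -/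
theorem stub_H8_e7 :
    ∀ (K : Type) [Field K] [NumberField K], NumberField.IsTotallyReal K → Module.finrank ℚ K = 4 →
      (∃ r : K, r ^ 2 = 5) → ∀ E : WeierstrassCurve (NumberField.RingOfIntegers K), E.Δ ≠ 0 →
      (∃ ρ : Literature.NumberTheory.GaloisRepresentations.FramedGaloisRep K (ZMod 3) 2, (∃ e : (E.baseChange K).geomTorsion ((3 : ℕ) : ℤ) ≃+ (Fin 2 → ZMod 3), ∀ (σ : Field.absoluteGaloisGroup K) (P : (E.baseChange K).geomTorsion ((3 : ℕ) : ℤ)), e (σ • P) = ((ρ σ : GL (Fin 2) (ZMod 3)) : Matrix (Fin 2) (Fin 2) (ZMod 3)) *ᵥ (e P)) ∧ ((∀ σ : Field.absoluteGaloisGroup K, (((ρ σ : GL (Fin 2) (ZMod 3)) : Matrix (Fin 2) (Fin 2) (ZMod 3)) 1 0 = 0)) ∨ (∀ σ : Field.absoluteGaloisGroup K, (ρ σ : GL (Fin 2) (ZMod 3)) ∈ Subgroup.closure ({(⟨!![1, 0; 0, 2], !![1, 0; 0, 2], by decide, by decide⟩ : GL (Fin 2) (ZMod 3)), (⟨!![0,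 1; 1, 0], !![0, 1; 1, 0], by decide, by decide⟩ : GL (Fin 2) (ZMod 3))} : Set (GL (Fin 2) (ZMod 3)))))) →
      (∃ ρ : Literature.NumberTheory.GaloisRepresentations.FramedGaloisRep K (ZMod 5) 2, (∃ e : (E.baseChange K).geomTorsion ((5 : ℕ) : ℤ) ≃+ (Fin 2 → ZMod 5), ∀ (σ : Field.absoluteGaloisGroup K) (P : (E.baseChange K).geomTorsion ((5 : ℕ) : ℤ)), e (σ • P) = ((ρ σ : GL (Fin 2) (ZMod 5)) : Matrix (Fin 2) (Fin 2) (ZMod 5)) *ᵥ (e P)) ∧ (∀ σ : Field.absoluteGaloisGroup K, (ρ σ : GL (Fin 2) (ZMod 5)) ∈ Subgroup.closure ({(⟨!![2, 0; 0, 3], !![3, 0; 0, 2], by decide, by decide⟩ : GL (Fin 2) (ZMod 5)), (⟨!![0, 1; 1, 0], !![0, 1; 1, 0], by decide, by decide⟩ : GL (Fin 2) (ZMod 5))} : Set (GL (Fin 2) (ZMod 5))))) →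
      (∃ ρ : Literature.NumberTheory.GaloisRepresentations.FramedGaloisRep K (ZMod 7) 2, (∃ e : (E.baseChange K).geomTorsion ((7 : ℕ) : ℤ) ≃+ (Fin 2 → ZMod 7), ∀ (σ : Field.absoluteGaloisGroup K) (P : (E.baseChange K).geomTorsion ((7 : ℕ) : ℤ)), e (σ • P) = ((ρ σ : GL (Fin 2) (ZMod 7)) : Matrix (Fin 2) (Fin 2) (ZMod 7)) *ᵥ (e P)) ∧ (∀ σ : Field.absoluteGaloisGroup K, (ρ σ : GL (Fin 2) (ZMod 7)) ∈ Subgroup.closure ({(⟨!![0, 5; 3, 0], !![0, 5; 3, 0], by decide, by decide⟩ : GL (Fin 2) (ZMod 7)), (⟨!![5, 0; 3, 2], !![3, 0; 6, 4], by decide, by decide⟩ : GL (Fin 2) (ZMod 7))} : Set (GL (Fin 2) (ZMod 7))))) →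
      ((E.baseChange K).HasCM ∨ ∃ (hF : Literature.NumberTheory.Automorphic.isCompact_glFiniteIntegralLevel 2 K) (π : Literature.NumberTheory.Automorphic.CuspidalAutomorphicRepData 2 K hF), π.1.HasWeightZero ∧ ∀ᶠ w : IsDedekindDomain.HeightOneSpectrum (NumberField.RingOfIntegers K) in Filter.cofinite, ∃ α : Multiset ℂ, π.1.HasSatakeParamAt w α ∧ ((Real.sqrt w.residueCard : ℝ) : ℂ) * α.sum = (Literature.NumberTheory.Automorphic.frobTraceAt E w : ℂ)) := by
  sorry

/-! ## The composition (kernel-checked; `sorry` only through the four stubs, used BY NAME) -/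

/-- **`RefinedLocusModular` from the four stubs.**  Destructure the mod-5 hypothesis `∃ ρ₅, framing ∧ (H8 ∨ H12)`
and the mod-7 hypothesis `∃ ρ₇, framing ∧ (Borel ∨ G(e7))`, split the two disjunctions, and in each of the four
cases re-pack the chosen disjunct and apply the corresponding stub.  Conclusion = the route decl
`Summit.Langlands.Langlands.Theses.SqrtFiveQuarticCovers.RefinedLocusModular`, by name. [folklore] -/
theorem RefinedLocusModular_of :
    Summit.Langlands.Langlands.Theses.SqrtFiveQuarticCovers.RefinedLocusModular := by
  intro K _ _ hK hdeg h5 E hE h3 h5im h7im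
  obtain ⟨ρ₅, hf₅, hH8 | hH12⟩ := h5im <;> obtain ⟨ρ₇, hf₇, hb7 | he7⟩ := h7im
  · exact stub_H8_b7 K hK hdeg h5 E hE h3 ⟨ρ₅, hf₅, hH8⟩ ⟨ρ₇, hf₇, hb7⟩
  · exact stub_H8_e7 K hK hdeg h5 E hE h3 ⟨ρ₅, hf₅, hH8⟩ ⟨ρ₇, hf₇, he7⟩
  · exact stub_H12_b7 K hK hdeg h5 E hE h3 ⟨ρ₅, hf₅, hH12⟩ ⟨ρ₇, hf₇, hb7⟩
  · exact stub_H12_e7 K hK hdeg h5 E hE h3 ⟨ρ₅, hf₅, hH12⟩ ⟨ρ₇, hf₇, he7⟩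

/-- **The same composition as PURE LOGIC, hypothetical form**
`<stub_H12_b7-sig> → <stub_H8_b7-sig> → <stub_H12_e7-sig> → <stub_H8_e7-sig> → RefinedLocusModular`
(sorry-free, axiom-clean: the real proof that the four stub STATEMENTS imply the crux; an `example` so that the
skeleton audit sees exactly one theorem concluding the crux; `type_of% @stub_…` is literally the stub's type). -/
example : type_of% @stub_H12_b7 → type_of% @stub_H8_b7 → type_of% @stub_H12_e7 → type_of% @stub_H8_e7 →
    Summit.Langlands.Langlands.Theses.SqrtFiveQuarticCovers.RefinedLocusModular := by
  intro hA hB hC hD K _ _ hK hdeg h5 E hE h3 h5im h7im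
  obtain ⟨ρ₅, hf₅, hH8 | hH12⟩ := h5im <;> obtain ⟨ρ₇, hf₇, hb7 | he7⟩ := h7im
  · exact hB K hK hdeg h5 E hE h3 ⟨ρ₅, hf₅, hH8⟩ ⟨ρ₇, hf₇, hb7⟩
  · exact hD K hK hdeg h5 E hE h3 ⟨ρ₅, hf₅, hH8⟩ ⟨ρ₇, hf₇, he7⟩
  · exact hA K hK hdeg h5 E hE h3 ⟨ρ₅, hf₅, hH12⟩ ⟨ρ₇, hf₇, hb7⟩
  · exact hC K hK hdeg h5 E hE h3 ⟨ρ₅, hf₅, hH12⟩ ⟨ρ₇, hf₇, he7⟩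

/-! ## Each stub is a consequence of the crux (no stub is harder than the crux; none IS the crux — BC3 probes in
`Lines/birth.md`).  Written as `example`s (nothing to register). -/

/-- The crux gives stub 1 (inject the `H12` and Borel-at-7 disjuncts). [folklore] -/
example (h : RefinedLocusModular) : type_of% @stub_H12_b7 :=
  fun K _ _ hK hdeg h5 E hE h3 ⟨ρ₅, hf₅, hv⟩ ⟨ρ₇, hf₇, hw⟩ =>
    h K hK hdeg h5 E hE h3 ⟨ρ₅, hf₅, Or.inr hv⟩ ⟨ρ₇, hf₇, Or.inl hw⟩

/-- The crux gives stub 2 (inject the `H8` and Borel-at-7 disjuncts). [folklore] -/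
example (h : RefinedLocusModular) : type_of% @stub_H8_b7 :=
  fun K _ _ hK hdeg h5 E hE h3 ⟨ρ₅, hf₅, hv⟩ ⟨ρ₇, hf₇, hw⟩ =>
    h K hK hdeg h5 E hE h3 ⟨ρ₅, hf₅, Or.inl hv⟩ ⟨ρ₇, hf₇, Or.inl hw⟩

/-- The crux gives stub 3 (inject the `H12` and `G(e7)` disjuncts). [folklore] -/
example (h : RefinedLocusModular) : type_of% @stub_H12_e7 :=
  fun K _ _ hK hdeg h5 E hE h3 ⟨ρ₅, hf₅, hv⟩ ⟨ρ₇, hf₇, hw⟩ =>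
    h K hK hdeg h5 E hE h3 ⟨ρ₅, hf₅, Or.inr hv⟩ ⟨ρ₇, hf₇, Or.inr hw⟩

/-- The crux gives stub 4 (inject the `H8` and `G(e7)` disjuncts). [folklore] -/
example (h : RefinedLocusModular) : type_of% @stub_H8_e7 :=
  fun K _ _ hK hdeg h5 E hE h3 ⟨ρ₅, hf₅, hv⟩ ⟨ρ₇, hf₇, hw⟩ =>
    h K hK hdeg h5 E hE h3 ⟨ρ₅, hf₅, Or.inl hv⟩ ⟨ρ₇, hf₇, Or.inr hw⟩

/-- Read-back: the route decl unfolds to the verbatim crux text from which the four stubs were cut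
(mod-5 disjunction `H8 ∨ H12`, mod-7 disjunction `Borel ∨ G(e7)`). [bookkeeping] -/
example : Summit.Langlands.Langlands.Theses.SqrtFiveQuarticCovers.RefinedLocusModular ↔
    (∀ (K : Type) [Field K] [NumberField K], NumberField.IsTotallyReal K → Module.finrank ℚ K = 4 → (∃ r : K, r ^ 2 = 5) → ∀ E : WeierstrassCurve (NumberField.RingOfIntegers K), E.Δ ≠ 0 → (∃ ρ : Literature.NumberTheory.GaloisRepresentations.FramedGaloisRep K (ZMod 3) 2, (∃ e : (E.baseChange K).geomTorsion ((3 : ℕ) : ℤ) ≃+ (Fin 2 → ZMod 3), ∀ (σ : Field.absoluteGaloisGroup K) (P : (E.baseChange K).geomTorsion ((3 : ℕ) : ℤ)), e (σ • P) = ((ρ σ : GL (Fin 2) (ZMod 3)) : Matrix (Fin 2) (Fin 2) (ZMod 3)) *ᵥ (e P)) ∧ ((∀ σ : Field.absoluteGaloisGroup K, (((ρ σ : GL (Fin 2) (ZMod 3)) : Matrix (Fin 2) (Fin 2) (ZMod 3)) 1 0 = 0)) ∨ (∀ σ : Field.absoluteGaloisGroup K, (ρ σ : GL (Fin 2) (ZMod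 3)) ∈ Subgroup.closure ({(⟨!![1, 0; 0, 2], !![1, 0; 0, 2], by decide, by decide⟩ : GL (Fin 2) (ZMod 3)), (⟨!![0, 1; 1, 0], !![0, 1; 1, 0], by decide, by decide⟩ : GL (Fin 2) (ZMod 3))} : Set (GL (Fin 2) (ZMod 3)))))) → (∃ ρ : Literature.NumberTheory.GaloisRepresentations.FramedGaloisRep K (ZMod 5) 2, (∃ e : (E.baseChange K).geomTorsion ((5 : ℕ) : ℤ) ≃+ (Fin 2 → ZMod 5), ∀ (σ : Field.absoluteGaloisGroup K) (P : (E.baseChange K).geomTorsion ((5 : ℕ) : ℤ)), e (σ • P) = ((ρ σ : GL (Fin 2) (ZMod 5)) : Matrix (Fin 2) (Fin 2) (ZMod 5)) *ᵥ (e P)) ∧ ((∀ σ : Field.absoluteGaloisGroup K, (ρ σ : GL (Fin 2) (ZMod 5)) ∈ Subgroup.closure ({(⟨!![2, 0; 0, 3], !![3, 0; 0, 2], by decide, by decide⟩ : GL (Fin 2) (ZMod 5)), (⟨!![0, 1; 1, 0], !![0, 1; 1, 0], by decide, by decide⟩ : GL (Fin 2) (ZMod 5))} : Set (GL (Fin 2)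 (ZMod 5)))) ∨ (∀ σ : Field.absoluteGaloisGroup K, (ρ σ : GL (Fin 2) (ZMod 5)) ∈ Subgroup.closure ({(⟨!![3, 1; 3, 3], !![3, 4; 2, 3], by decide, by decide⟩ : GL (Fin 2) (ZMod 5)), (⟨!![1, 0; 0, 4], !![1, 0; 0, 4], by decide, by decide⟩ : GL (Fin 2) (ZMod 5))} : Set (GL (Fin 2) (ZMod 5)))))) → (∃ ρ : Literature.NumberTheory.GaloisRepresentations.FramedGaloisRep K (ZMod 7) 2, (∃ e : (E.baseChange K).geomTorsion ((7 : ℕ) : ℤ) ≃+ (Fin 2 → ZMod 7), ∀ (σ : Field.absoluteGaloisGroup K) (P : (E.baseChange K).geomTorsion ((7 : ℕ) : ℤ)), e (σ • P) = ((ρ σ : GL (Fin 2) (ZMod 7)) : Matrix (Fin 2) (Fin 2) (ZMod 7)) *ᵥ (e P)) ∧ ((∀ σ : Field.absoluteGaloisGroup K, (((ρ σ : GL (Fin 2) (ZMod 7)) : Matrix (Fin 2) (Fin 2) (ZMod 7)) 1 0 = 0)) ∨ (∀ σ : Field.absoluteGaloisGroup K, (ρ σ : GL (Fin 2) (ZMod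 7)) ∈ Subgroup.closure ({(⟨!![0, 5; 3, 0], !![0, 5; 3, 0], by decide, by decide⟩ : GL (Fin 2) (ZMod 7)), (⟨!![5, 0; 3, 2], !![3, 0; 6, 4], by decide, by decide⟩ : GL (Fin 2) (ZMod 7))} : Set (GL (Fin 2) (ZMod 7)))))) → ((E.baseChange K).HasCM ∨ ∃ (hF : Literature.NumberTheory.Automorphic.isCompact_glFiniteIntegralLevel 2 K) (π : Literature.NumberTheory.Automorphic.CuspidalAutomorphicRepData 2 K hF), π.1.HasWeightZero ∧ ∀ᶠ w : IsDedekindDomain.HeightOneSpectrum (NumberField.RingOfIntegers K) in Filter.cofinite, ∃ α : Multiset ℂ, π.1.HasSatakeParamAt w α ∧ ((Real.sqrt w.residueCard : ℝ) : ℂ) * α.sum = (Literature.NumberTheory.Automorphic.frobTraceAt E w : ℂ))) :=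
  Iff.rfl

end Summit.Langlands.Langlands.Cruxes.RefinedLocusModular.Birth
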